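import Literature.AlgebraicGeometry.HodgeTheory.ChernCharacterBettiLaws
import Literature.AlgebraicGeometry.HodgeTheory.AlgebraicClassesGysinOneSpan
import Literature.AlgebraicGeometry.KTheory.CoherentGrothendieckGroup
import Literature.AlgebraicGeometry.KTheory.EulerCharShortExact
import Literature.AlgebraicGeometry.Modules.BoundedCoherentVBModelsProjective
import Literature.AlgebraicGeometry.Modules.VectorBundleFiniteLocallyFree
import HarnessLib

/-!
# The Chern character of a lawful raw datum on `K₀(X)` and on `K(X)`, and the span law reduced to Gysin generators

Family `hodge`, layer `Literature/AlgebraicGeometry/HodgeTheory`. HONEST FRAMING: nothing here constructs a Chern character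
or bears on any case of the Hodge conjecture; `ChernCharacterBetti` stays a hypothesis structure without an instance. This is the
`K`-theoretic companion of `HodgeTheory/ChernCharacterBettiLaws` (the nine topological laws `ChernDatum.IsTopological` of a RAW
datum `ch : ChernDatum`) in the style of `HodgeTheory/SemiregularVariationalHodgeTwistedPerfect` §1 (`chKZero C` for a STRUCTURE
`C : ChernCharacterBetti`) and `HodgeTheory/ChernCharacterCoherentSmoothProjective` (`chCoh C` on smooth projective varieties):
only ADDITIVITY of `ch` on short exact sequences of vector bundles is needed to put `ch_k` on the Grothendieck group of vector
bundles, and on a SMOOTH PROJECTIVE variety — where every coherent sheaf has a finite locally free resolution, independent of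
choices in `K₀` (Hartshorne III Ex. 6.9, both clauses THEOREMS of the tree: `Modules.IsSmoothProjective.nonempty_strictlyPerfect
Resolution_of_coh`, `KTheory.IsSmoothProjective.ofCoh_eq ∕ ofCoh_shortExact`) — on Hartshorne's `K(X)` of coherent sheaves
(`KTheory.KZeroCoh`). Fulton, Intersection Theory §15.1 with App. B.8.3: «on a non-singular variety `K°X ≅ K°X`, so `ch` is
defined on coherent sheaves».

## What is here (namespace `Literature.AlgebraicGeometry.HodgeTheory.ChernDatum`)

* §1 `ChernDatum.chKZero ch hadd X k : K₀(X) →+ H²ᵏ(X(ℂ); ℂ)` for a raw datum additive on short exact sequences of vector bundles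
  (`hadd`, the field `ChernDatum.IsTopological.ch_shortExact`), on ANY `ℂ`-scheme; `chKZero_of`; **`chKZero_mem_span`**: every value
  lies in `ℂ · {ch_k(E) : E a vector bundle}`; naturality `map_chKZero` under the functoriality law.
* §2 on a smooth projective `X`: **`ChernDatum.chKZeroCoh ch hadd hX k : K(X) →+ H²ᵏ(X(ℂ); ℂ)`**, `[F] ↦ Σᵢ (−1)ⁱ ch_k(ℰᵢ)` on a
  finite locally free resolution `ℰ• → F` (which exists; the value does not depend on it: `chKZeroCoh_of`); `chKZeroCoh_toKZeroCoh`
  (`= chKZero` on classes of vector bundles), `chKZeroCoh_of_isFiniteLocallyFree`, **`chKZeroCoh_mem_span`** (every `ch_k` of a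
  class of coherent sheaves is a `ℂ`-combination of `ch_k` of vector bundles), `chKZeroCoh_mem_algebraicClasses` (for a lawful datum).
* §3 the SPAN LAW of a lawful datum REDUCED TO GYSIN GENERATORS: by `algebraicClasses_eq_span_complexGysin_one` (Grothendieck's Gysin
  description of coniveau, a theorem of the tree) `Nᵖ H²ᵖ(X(ℂ); ℂ) = ℂ · {g_* 1_V : g : V ⟶ X, V smooth projective of dimension n − p}`,
  so **`algebraicClasses_le_span_of_forall_complexGysin_one_mem`**: `Nᵖ H²ᵖ ⊆ ℂ · {ch_p(E)}` as soon as each `g_* 1_V` lies there, and the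
  `K`-theoretic form **`algebraicClasses_le_span_of_forall_exists_chKZeroCoh_eq_smul`**: it suffices that each `g_* 1_V` be, up to a
  non-zero scalar, `ch_p` of a class in `K(X)` — the shape of the LEADING TERM OF GROTHENDIECK–RIEMANN–ROCH for `g`
  («`ch(f_* α) = f_*(ch(α) · td(T_f))`», Fulton Thm. 15.2, in lowest codimension: `ch_p(R g_* 𝒪_V) = g_* 1_V`), which is therefore
  the EXACT remaining content of the span law in degrees `1 ≤ p ≤ dim X`; degrees `p > dim X` are free
  (`algebraicClasses_le_span_of_dim_lt`, `H²ᵖ(X(ℂ); ℂ) = 0`), degree `0` is `ChernDatum.IsTopological.span_ch_zero_eq_top`.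

No instance, no notation, no named fact; the two definitions are `AddMonoidHom`s built with the universal properties
`KTheory.KZero.lift` ∕ `KTheory.KZeroCoh.lift` of the tree.

## References

* [Fulton1998] W. Fulton, Intersection Theory, 2nd ed. (1998): §15.1 (p. 280–283), Example 3.2.3, Thm. 15.2, Example 15.2.16 (b),
  App. B.8.3, §19.1 Lemma 19.1.1.
* [Hartshorne1977] R. Hartshorne, Algebraic Geometry (1977): II Ex. 6.10 (p. 148), III Ex. 6.9 (p. 238–239).
* [BorelSerre1958] A. Borel, J.-P. Serre, Le théorème de Riemann–Roch, Bull. SMF 86 (1958): §4 Lemmes 11–12, §7.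
* [Deligne2000] P. Deligne, The Hodge conjecture (Clay, 2000): §2 Remark (ii) («one resolves `𝒪_Z` by a finite complex of vector
  bundles»).
* Tree: `HodgeTheory/ChernCharacterBettiLaws`, `HodgeTheory/AlgebraicClassesGysinOneSpan`, `KTheory/CoherentGrothendieckGroup`,
  `KTheory/EulerCharShortExact`, `Modules/BoundedCoherentVBModelsProjective`.
-/

noncomputable section

open CategoryTheory CategoryTheory.Limits AlgebraicGeometry
open Literature.AlgebraicTopology.SingularHomology
open Literature.AlgebraicGeometry.Motives Literature.AlgebraicGeometry.Modules Literature.AlgebraicGeometry.Morphisms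
open Literature.AlgebraicGeometry.KTheory
open Literature.AlgebraicGeometry.KTheory.Adapted (coh_of_isFiniteLocallyFree)

namespace Literature.AlgebraicGeometry.HodgeTheory

namespace ChernDatum

section HodgeTheory

variable (ch : ChernDatum)
  (hadd : ∀ {X : SchemeOver ℂ} (S : ShortComplex X.left.Modules), S.ShortExact →
    IsVectorBundle S.X₁ → IsVectorBundle S.X₃ → ∀ i : ℕ, ch X S.X₂ i = ch X S.X₁ i + ch X S.X₃ i)

/-! ### §1 `ch_k` on the Grothendieck group of vector bundles (any `ℂ`-scheme) -/

/-- **The Chern character of an additive raw datum on `K₀(X)`**, degree `k`: `ch_k : K₀(X) →+ H²ᵏ(X(ℂ); ℂ)`, `[E] ↦ ch_k(E)`,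
well defined by additivity on short exact sequences of vector bundles («`ch : K(X) → A(X)_ℚ` determined by the following
properties»). [cite: Fulton1998, §15.1 and Example 3.2.3] -/
def chKZero (X : SchemeOver ℂ) (k : ℕ) : KZero X.left →+ complexBetti X (2 * k) :=
  KZero.lift (fun E _ => ch X E k) fun S hS h₁ _ h₃ => hadd S hS h₁.isVectorBundle h₃.isVectorBundle k

variable (X : SchemeOver ℂ)

/-- `ch_k([E]) = ch_k(E)` on the class of a vector bundle. [cite: Fulton1998, §15.1] -/
@[simp]
theorem chKZero_of (k : ℕ) (E : X.left.Modules) (hE : IsFiniteLocallyFree E) :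
    chKZero ch hadd X k (KZero.of E hE) = ch X E k :=
  KZero.lift_of _ _ E hE

/-- **Every value of `ch_k` on `K₀(X)` is a `ℂ`-combination of the `ch_k(E)`, `E` a vector bundle** (the classes `[E]` generate
`K₀(X)`, §15.1). [cite: Fulton1998, §15.1] -/
theorem chKZero_mem_span (k : ℕ) (x : KZero X.left) :
    chKZero ch hadd X k x ∈ Submodule.span ℂ {c | ∃ E : X.left.Modules, IsVectorBundle E ∧ ch X E k = c} := by
  induction x using KZero.induction_on with
  | zero => rw [map_zero]; exact Submodule.zero_mem _
  | of E hE => rw [chKZero_of]; exact Submodule.subset_span ⟨E, hE.isVectorBundle, rfl⟩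
  | neg x hx => rw [map_neg]; exact Submodule.neg_mem _ hx
  | add x y hx hy => rw [map_add]; exact Submodule.add_mem _ hx hy

variable {X} in
/-- **Naturality**: `f^*(ch_k(x)) = ch_k(f^* x)` for `x ∈ K₀(X)`, from the functoriality law on vector bundles (the generators).
[cite: Fulton1998, §15.1 (ii)] -/
theorem map_chKZero
    (hmap : ∀ {X Y : SchemeOver ℂ} (f : Y ⟶ X) (E : X.left.Modules), IsVectorBundle E →
      ∀ i : ℕ, complexBetti.map f (2 * i) (ch X E i) = ch Y ((Scheme.Modules.pullback f.left).obj E) i)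
    {Y : SchemeOver ℂ} (f : Y ⟶ X) (k : ℕ) (x : KZero X.left) :
    complexBetti.map f (2 * k) (chKZero ch hadd X k x) = chKZero ch hadd Y k (KZero.map f.left x) := by
  induction x using KZero.induction_on with
  | zero => simp only [map_zero]
  | of E hE => rw [chKZero_of, KZero.map_of, chKZero_of]; exact hmap f E hE.isVectorBundle k
  | neg x hx => simp only [map_neg, hx]
  | add x y hx hy => simp only [map_add, hx, hy]

/-- On a smooth projective `X`, every value of `ch_k` on `K₀(X)` is an ALGEBRAIC class, for a datum with the congruence,
additivity, functoriality and rank-`≤ 1` exponential laws (`ch_mem_algebraicClasses_of_laws` on the generators).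
[cite: Fulton1998, Prop. 19.1.2 and Cor. 19.2 (b)] -/
theorem chKZero_mem_algebraicClasses (h : ch.IsTopological) {n : ℕ} (hX : IsSmoothProjective n X) (k : ℕ) (x : KZero X.left) :
    chKZero ch hadd X k x ∈ algebraicClasses X k := by
  induction x using KZero.induction_on with
  | zero => rw [map_zero]; exact Submodule.zero_mem _
  | of E hE => rw [chKZero_of]; exact h.ch_mem_algebraicClasses hX E hE.isVectorBundle k
  | neg x hx => rw [map_neg]; exact Submodule.neg_mem _ hx
  | add x y hx hy => rw [map_add]; exact Submodule.add_mem _ hx hy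

/-! ### §2 `ch_k` on Hartshorne's `K(X)` of coherent sheaves of a smooth projective variety -/

variable {X}
variable {n : ℕ}

/-- **The Chern character of an additive raw datum on `K(X)`**, `X` smooth projective: `[F] ↦ ch_k([F]_{ℰ•}) = Σᵢ (−1)ⁱ ch_k(ℰᵢ)`
for a finite locally free resolution `ℰ• → F → 0` of the coherent sheaf `F` — which EXISTS on a smooth projective variety
(Hartshorne III Ex. 6.9 (a), the tree's `Modules.IsSmoothProjective.nonempty_strictlyPerfectResolution_of_coh`), a choice of which
does not matter (`chKZeroCoh_of`), and which is additive on short exact sequences of coherent sheaves (III Ex. 6.9 (b), the tree's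
`KTheory.IsSmoothProjective.ofCoh_shortExact`), so that the assignment descends to `K(X)` (`KTheory.KZeroCoh.lift`). «On a
non-singular variety `K°X ≅ K°X`, so `ch` is defined on coherent sheaves.» [cite: Fulton1998, §15.1 with App. B.8.3]
[cite: Hartshorne1977, III Ex. 6.9 (p. 238–239)] -/
def chKZeroCoh (hX : IsSmoothProjective n X) (k : ℕ) : KZeroCoh X.left →+ complexBetti X (2 * k) :=
  KZeroCoh.lift
    (fun F hF ↦ chKZero ch hadd X k
      (KZero.ofCoh F (Classical.choice (Modules.IsSmoothProjective.nonempty_strictlyPerfectResolution_of_coh hX hF))))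
    (fun S hS _ h₂ _ ↦ by rw [KTheory.IsSmoothProjective.ofCoh_shortExact hX hS h₂, map_add])

/-- **Resolution independence**: `ch_k([F]) = ch_k([F]_{ℰ•}) = Σᵢ (−1)ⁱ ch_k(ℰᵢ)` for EVERY finite locally free resolution `ℰ•`
of the coherent `F` (`KTheory.IsSmoothProjective.ofCoh_eq`). [cite: Hartshorne1977, III Ex. 6.9 (b) (p. 239)]
[cite: Fulton1998, App. B.8.3 (v)] -/
theorem chKZeroCoh_of (hX : IsSmoothProjective n X) (k : ℕ) {F : X.left.Modules} (hF : Coh F)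
    (R : StrictlyPerfectResolution F) :
    chKZeroCoh ch hadd hX k (KZeroCoh.of F hF) = chKZero ch hadd X k (KZero.ofCoh F R) := by
  rw [chKZeroCoh, KZeroCoh.lift_of, KTheory.IsSmoothProjective.ofCoh_eq hX hF _ R]

/-- **Alternating sum**: `ch_k([F]) = Σ_{i ∈ s} (−1)ⁱ ch_k(ℰ•ⁱ)` for any finite locally free resolution `ℰ•` of `F` and any finite set
`s` of degrees off which the resolving complex vanishes. [cite: Fulton1998, §15.1 and Example 3.2.3] [cite: BorelSerre1958, §4 Lemme 12] -/
theorem chKZeroCoh_of_eq_sum (hX : IsSmoothProjective n X) (k : ℕ) {F : X.left.Modules} (hF : Coh F)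
    (R : StrictlyPerfectResolution F) (s : Finset ℤ) (hs : ∀ i ∉ s, IsZero (R.P.X i)) :
    chKZeroCoh ch hadd hX k (KZeroCoh.of F hF) = ∑ i ∈ s, ((i.negOnePow : ℤˣ) : ℤ) • ch X (R.P.X i) k := by
  rw [chKZeroCoh_of ch hadd hX k hF R, KZero.ofCoh, eulerChar_eq_sum R.isBoundedVB.isFiniteLocallyFree s hs, map_sum]
  refine Finset.sum_congr rfl fun i _ ↦ ?_
  rw [map_zsmul, chKZero_of]

/-- **`ch_k(ε x) = ch_k(x)`**: on the image of `ε : K₀(X) → K(X)` the coherent Chern character is the vector-bundle one.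
[cite: Hartshorne1977, III Ex. 6.9 (b) (p. 239)] [cite: Fulton1998, §15.1] -/
theorem chKZeroCoh_toKZeroCoh (hX : IsSmoothProjective n X) (k : ℕ) (x : KZero X.left) :
    chKZeroCoh ch hadd hX k (KZero.toKZeroCoh x) = chKZero ch hadd X k x := by
  induction x using KZero.induction_on with
  | zero => simp only [map_zero]
  | of E hE =>
    rw [KZero.toKZeroCoh_of E hE (coh_of_isFiniteLocallyFree hE),
      chKZeroCoh_of ch hadd hX k (coh_of_isFiniteLocallyFree hE) (StrictlyPerfectResolution.ofFiniteLocallyFree hE),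
      KZero.ofCoh_ofFiniteLocallyFree]
  | neg x hx => simp only [map_neg, hx]
  | add x y hx hy => simp only [map_add, hx, hy]

/-- **`ch_k([E]) = ch_k(E)` for a vector bundle `E`** regarded as a coherent sheaf. [cite: Fulton1998, §15.1]
[cite: Hartshorne1977, III Ex. 6.9 (b) (p. 239)] -/
theorem chKZeroCoh_of_isFiniteLocallyFree (hX : IsSmoothProjective n X) (k : ℕ) {E : X.left.Modules}
    (hE : IsFiniteLocallyFree E) (hE' : Coh E) : chKZeroCoh ch hadd hX k (KZeroCoh.of E hE') = ch X E k := by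
  rw [← KZero.toKZeroCoh_of E hE hE', chKZeroCoh_toKZeroCoh, chKZero_of]

/-- Isomorphic coherent sheaves have the same `ch_k`. [cite: Hartshorne1977, II Ex. 6.10 (p. 148)] -/
theorem chKZeroCoh_congr (hX : IsSmoothProjective n X) (k : ℕ) {F F' : X.left.Modules} (e : F ≅ F') (hF : Coh F)
    (hF' : Coh F') : chKZeroCoh ch hadd hX k (KZeroCoh.of F hF) = chKZeroCoh ch hadd hX k (KZeroCoh.of F' hF') := by
  rw [KZeroCoh.of_iso e hF hF']

/-- `ch_k` of a zero sheaf vanishes. [cite: Hartshorne1977, II Ex. 6.10 (p. 148)] -/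
theorem chKZeroCoh_of_isZero (hX : IsSmoothProjective n X) (k : ℕ) {F : X.left.Modules} (hF : IsZero F) (hF' : Coh F) :
    chKZeroCoh ch hadd hX k (KZeroCoh.of F hF') = 0 := by
  rw [KZeroCoh.of_isZero hF hF', map_zero]

/-- **Additivity of `ch_k` on short exact sequences of coherent sheaves** (built into `K(X)`).
[cite: Hartshorne1977, III Ex. 6.9 (b) (p. 239)] [cite: Fulton1998, §15.1 (with App. B.8.3 (iii))] -/
theorem chKZeroCoh_shortExact (hX : IsSmoothProjective n X) (k : ℕ) {S : ShortComplex X.left.Modules}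
    (hS : S.ShortExact) (h₁ : Coh S.X₁) (h₂ : Coh S.X₂) (h₃ : Coh S.X₃) :
    chKZeroCoh ch hadd hX k (KZeroCoh.of S.X₂ h₂) =
      chKZeroCoh ch hadd hX k (KZeroCoh.of S.X₁ h₁) + chKZeroCoh ch hadd hX k (KZeroCoh.of S.X₃ h₃) := by
  rw [KZeroCoh.of_shortExact hS h₁ h₂ h₃, map_add]

/-- **Every `ch_k` of a class of coherent sheaves is a `ℂ`-combination of `ch_k` of vector bundles** («one resolves `𝒪_Z` by a
finite complex of vector bundles»): `ch_k(y) ∈ ℂ · {ch_k(E) : E a vector bundle}` for every `y ∈ K(X)`.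
[cite: Deligne2000, §2 Remark (ii)] [cite: Fulton1998, §15.1 with App. B.8.3] -/
theorem chKZeroCoh_mem_span (hX : IsSmoothProjective n X) (k : ℕ) (y : KZeroCoh X.left) :
    chKZeroCoh ch hadd hX k y ∈ Submodule.span ℂ {c | ∃ E : X.left.Modules, IsVectorBundle E ∧ ch X E k = c} := by
  induction y using KZeroCoh.induction_on with
  | zero => rw [map_zero]; exact Submodule.zero_mem _
  | of F hF =>
    obtain ⟨R⟩ := Modules.IsSmoothProjective.nonempty_strictlyPerfectResolution_of_coh hX hF
    rw [chKZeroCoh_of ch hadd hX k hF R]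
    exact chKZero_mem_span ch hadd X k _
  | neg x hx => rw [map_neg]; exact Submodule.neg_mem _ hx
  | add x y hx hy => rw [map_add]; exact Submodule.add_mem _ hx hy

/-- On a smooth projective `X`, every `ch_k(y)`, `y ∈ K(X)`, is an ALGEBRAIC class (lawful datum).
[cite: Fulton1998, Prop. 19.1.2 and Cor. 19.2 (b)] -/
theorem chKZeroCoh_mem_algebraicClasses (h : ch.IsTopological) (hX : IsSmoothProjective n X) (k : ℕ) (y : KZeroCoh X.left) :
    chKZeroCoh ch hadd hX k y ∈ algebraicClasses X k := by
  induction y using KZeroCoh.induction_on with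
  | zero => rw [map_zero]; exact Submodule.zero_mem _
  | of F hF =>
    obtain ⟨R⟩ := Modules.IsSmoothProjective.nonempty_strictlyPerfectResolution_of_coh hX hF
    rw [chKZeroCoh_of ch hadd hX k hF R]
    exact chKZero_mem_algebraicClasses ch hadd X h hX k _
  | neg x hx => rw [map_neg]; exact Submodule.neg_mem _ hx
  | add x y hx hy => rw [map_add]; exact Submodule.add_mem _ hx hy

/-! ### §3 The span law of a lawful datum, reduced to the Gysin generators `g_* 1_V` -/

/-- **The span law in degree `p` follows from the membership of the Gysin generators**: if for every morphism `g : V ⟶ X` from a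
smooth projective variety of dimension `d = n − p` the class `g_* 1_V` is a `ℂ`-combination of the `ch_p(E)`, then so is every class
of `Nᵖ H²ᵖ(X(ℂ); ℂ)` — because `Nᵖ H²ᵖ = ℂ · {g_* 1_V}` (`algebraicClasses_eq_span_complexGysin_one`, for any orientation family `μ`).
[cite: Fulton1998, §19.1 Lemma 19.1.1 and Example 15.2.16 (b)] [cite: Deligne2000, §2 Remark (ii)] -/
theorem algebraicClasses_le_span_of_forall_complexGysin_one_mem (μ : OrientationFamily) (hX : IsSmoothProjective n X)
    {p d : ℕ} (hdp : d + p = n)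
    (H : ∀ (V : SchemeOver ℂ) (hV : IsSmoothProjective d V) (g : V ⟶ X),
      complexGysin μ hV hX g (a := 0) (b := 2 * p) (by omega) (singularCohomology.one ℂ (ComplexPoints V)) ∈
        Submodule.span ℂ {c | ∃ E : X.left.Modules, IsVectorBundle E ∧ ch X E p = c}) :
    algebraicClasses X p ≤ Submodule.span ℂ {c | ∃ E : X.left.Modules, IsVectorBundle E ∧ ch X E p = c} := by
  rw [algebraicClasses_eq_span_complexGysin_one μ p d hdp hX]
  refine Submodule.span_le.2 ?_
  rintro c ⟨V, hV, g, rfl⟩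
  exact H V hV g

/-- **`K`-theoretic form — the shape of the leading term of Grothendieck–Riemann–Roch**: if every Gysin generator `g_* 1_V`
(`g : V ⟶ X`, `V` smooth projective of dimension `n − p`) is, up to a NON-ZERO scalar, the degree-`p` Chern character of a class
`y ∈ K(X)` of coherent sheaves (in print: `y = R g_* 𝒪_V = Σ (−1)ⁱ [Rⁱ g_* 𝒪_V]`, scalar `λᵖ` for a datum of scale `λ`:
«`ch(f_* α) · td(T_Y) = f_*(ch(α) · td(T_X))`» read in lowest codimension), then the span law holds in degree `p`.
[cite: Fulton1998, Thm. 15.2 and Example 15.2.16 (b)] [cite: BorelSerre1958, §7] [cite: Deligne2000, §2 Remark (ii)] -/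
theorem algebraicClasses_le_span_of_forall_exists_chKZeroCoh_eq_smul (μ : OrientationFamily) (hX : IsSmoothProjective n X)
    {p d : ℕ} (hdp : d + p = n)
    (H : ∀ (V : SchemeOver ℂ) (hV : IsSmoothProjective d V) (g : V ⟶ X), ∃ (y : KZeroCoh X.left) (c : ℂ), c ≠ 0 ∧
      chKZeroCoh ch hadd hX p y =
        c • complexGysin μ hV hX g (a := 0) (b := 2 * p) (by omega) (singularCohomology.one ℂ (ComplexPoints V))) :
    algebraicClasses X p ≤ Submodule.span ℂ {c | ∃ E : X.left.Modules, IsVectorBundle E ∧ ch X E p = c} := by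
  refine algebraicClasses_le_span_of_forall_complexGysin_one_mem ch μ hX hdp fun V hV g ↦ ?_
  obtain ⟨y, c, hc, hy⟩ := H V hV g
  have hmem := chKZeroCoh_mem_span ch hadd hX p y
  rw [hy] at hmem
  have h' := Submodule.smul_mem _ c⁻¹ hmem
  rwa [smul_smul, inv_mul_cancel₀ hc, one_smul] at h'

/-- **Degrees above the dimension are free**: `H²ᵖ(X(ℂ); ℂ) = 0` for `p > dim X`, so the span law holds there for every datum.
[cite: HatcherAT2002, §3.3 Thm. 3.26 (c)] [cite: Fulton1998, Example 15.2.16 (b)] -/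
theorem algebraicClasses_le_span_of_dim_lt (hX : IsSmoothProjective n X) {p : ℕ} (hp : n < p) :
    algebraicClasses X p ≤ Submodule.span ℂ {c | ∃ E : X.left.Modules, IsVectorBundle E ∧ ch X E p = c} := by
  haveI := subsingleton_complexBetti hX (k := 2 * p) (by omega)
  intro c _
  rw [Subsingleton.elim c 0]
  exact Submodule.zero_mem _

/-- **The span law of a lawful datum in ALL positive degrees, from the Gysin memberships in degrees `1 ≤ p ≤ dim X`** (the
hypothesis shape `SpanForOne` of the crux line `grothendieck_axiomatic` of `ChernCharacterOnBetti`, with `p > dim X` discharged).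
[cite: Fulton1998, Example 15.2.16 (b) and §19.1 Lemma 19.1.1] [cite: Deligne2000, §2 Remark (ii)] -/
theorem algebraicClasses_le_span_of_forall_complexGysin_one_mem_of_le (μ : OrientationFamily) (hX : IsSmoothProjective n X)
    (H : ∀ {p d : ℕ} (_ : 0 < p) (hdp : d + p = n) (V : SchemeOver ℂ) (hV : IsSmoothProjective d V) (g : V ⟶ X),
      complexGysin μ hV hX g (a := 0) (b := 2 * p) (by omega) (singularCohomology.one ℂ (ComplexPoints V)) ∈
        Submodule.span ℂ {c | ∃ E : X.left.Modules, IsVectorBundle E ∧ ch X E p = c})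
    {p : ℕ} (hp : 0 < p) :
    algebraicClasses X p ≤ Submodule.span ℂ {c | ∃ E : X.left.Modules, IsVectorBundle E ∧ ch X E p = c} := by
  rcases le_or_gt p n with hpn | hpn
  · exact algebraicClasses_le_span_of_forall_complexGysin_one_mem ch μ hX (d := n - p) (by omega)
      fun V hV g ↦ H hp (by omega) V hV g
  · exact algebraicClasses_le_span_of_dim_lt ch hX hpn

end HodgeTheory

end ChernDatum

end Literature.AlgebraicGeometry.HodgeTheory

end
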